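import Summits.BirchSwinnertonDyer.BirchSwinnertonDyer.Theorems.SignedLowerHalvesKobayashiLowerHalfLargeImageCongruenceRecords03
import HarnessLib

/-!
# Route `SignedLowerHalves`, crux `KobayashiLowerHalfLargeImage` (item stmt-BirchSwinnertonDyer-19001):
# congruence-road RECORDS, part 03BSD — `congl_11858w1_3`: item 3's statement `∃ ε, KobayashiLowerDivisibility W 3 ε`
# and `BSDp W 3` AT THE PAIR, from part 03's `KobayashiMainConjecture W 3 ε` (`ε = −1` and `ε = +1`) (cell `bsd-ssimc`, seat
# `bsd-ssimc-k3-c3` gen 7, object «CONG-λ-CORE», planner D23-3; `--supports stmt-BirchSwinnertonDyer-19001 --as helper`)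

PARTITION (cell bsd-ssimc): X7 (A7) × the ENGINE-FREE-CORE pair `(11858w1, 3)` of item 3's rank-one window —
closes PER PAIR only (item 3's conclusion at the pair; `BSD(E,3)` with Burungale–Kobayashi–Ota Cor. A.5's two
referee flags displayed through `hA5`, exactly as every `mtroad`/`congl` BSDp record); crux OPEN; nothing booked;
BSD is not proved by any of this (and `BSD₃` at this pair is already a theorem by other roads). THEOREMS ONLY.

References: [Kobayashi2003] Conj. (p. 2), Thm. 4.1, 7.4; [BurungaleKobayashiOta2023] App. A Cor. A.5;
[BDKim2009] Cor. 2.13; [Cremona2006] Table 1.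
-/

set_option autoImplicit false
set_option linter.dupNamespace false
noncomputable section

open scoped Classical MatrixGroups ModularForm BigOperators

open CongruenceSubgroup WeierstrassCurve NumberField IsDedekindDomain Rat.HeightOneSpectrum
  Literature.NumberTheory.EllipticCurves
  Literature.NumberTheory.EllipticCurves.ModularForms
  Literature.NumberTheory.EllipticCurves.Rank1Residual
  Literature.NumberTheory.EllipticCurves.Rank1Residual.Typed
  Literature.NumberTheory.EllipticCurves.Kobayashi2003 ZpExtension
  Literature.NumberTheory.EllipticCurves.GreenbergVatsal2000
  Literature.NumberTheory.EllipticCurves.BurungaleKobayashiOta2024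
  Literature.NumberTheory.EllipticCurves.Fisher2012
  Literature.NumberTheory.EllipticCurves.Rank1Residual.X11RankOneCertificates
  Literature.NumberTheory.GaloisRepresentations
  Summit.BirchSwinnertonDyer.Rank1Residual.X1.MuLambda
  Summit.BirchSwinnertonDyer.Rank1Residual.Supersingular
  Summit.BirchSwinnertonDyer.Rank1Residual.X2.LocalDeltaCalculus
  Summit.BirchSwinnertonDyer.BirchSwinnertonDyer.Rank1Residual.IntModel
  Summit.BirchSwinnertonDyer.BirchSwinnertonDyer.Rank1Residual.X11RankOne
  Summit.BirchSwinnertonDyer.Rank1Residual.X11b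

namespace Summit.BirchSwinnertonDyer.BirchSwinnertonDyer.Theorems.CongruenceRoad

/-- **`congl_11858w1_3`, item 3's statement AT THE PAIR**: `∃ ε, KobayashiLowerDivisibility W 3 ε` for `11858w1`
(indeed the full signed main conjecture for `ε = −1`, `congl_kobayashiMainConjecture_11858w1_3_odd`). PER PAIR;
nothing booked. [cite: Kobayashi2003, Conjecture (p. 2) and Thm. 4.1] [cite: BDKim2009, Cor. 2.13 (p. 187)]
[cite: Cremona2006, Table 1 (Cremona labels 11858w1, 1694c1)] -/
theorem congl_kobayashiLowerDivisibility_11858w1_3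
    (h12 : Kobayashi2003.thm12_signedSelmerDual_finite_torsion)
    (h41 : Kobayashi2003.thm41_signedCharIdeal_divisibility)
    (h5 : realPeriodRat_eq_unit_mul_plusPeriod) (h3 : realPeriodRat_eq_unit_mul_plusPeriod_three)
    (hL20 : Wuthrich2014.lemma20_surjective_threeAdic_of_semistable)
    (hKim : BDKim2009.cor213_signedLambda_add_sum_delta_eq_of_torsionIso)
    (hGZK : rank_eq_analyticRank_of_analyticRank_le_one)
    [(⟨1, -1, 1, -34, 25⟩ : WeierstrassCurve ℚ).IsElliptic]
    [(⟨1, -1, 1, -34, 25⟩ : WeierstrassCurve ℚ).IsGloballyMinimal]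
    [(⟨1, -1, 0, -50, -236⟩ : WeierstrassCurve ℚ).IsElliptic]
    [(⟨1, -1, 0, -50, -236⟩ : WeierstrassCurve ℚ).IsGloballyMinimal]
    (hPollack : ∀ {N : ℕ} [NeZero N] {f : CuspForm (Gamma0 N) 2},
      pollack_exists_plusMinusPAdicLFunction (W := (⟨1, -1, 0, -50, -236⟩ : WeierstrassCurve ℚ))
        (f := f) (p := 3))
    [NeZero ((⟨1, -1, 1, -34, 25⟩ : WeierstrassCurve ℚ).conductorNorm ℤ)]
    [NeZero ((⟨1, -1, 0, -50, -236⟩ : WeierstrassCurve ℚ).conductorNorm ℤ)]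
    {f₀ : CuspForm (Gamma0 ((⟨1, -1, 1, -34, 25⟩ : WeierstrassCurve ℚ).conductorNorm ℤ)) 2}
    (hf₀ : IsNewformOf (⟨1, -1, 1, -34, 25⟩ : WeierstrassCurve ℚ) f₀)
    {f₀' : CuspForm (Gamma0 ((⟨1, -1, 0, -50, -236⟩ : WeierstrassCurve ℚ).conductorNorm ℤ)) 2}
    (hf₀' : IsNewformOf (⟨1, -1, 0, -50, -236⟩ : WeierstrassCurve ℚ) f₀')
    (hr' : (⟨1, -1, 0, -50, -236⟩ : WeierstrassCurve ℚ).analyticRank = 1)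
    {Θ : IwasawaAlgebra 3}
    (hΘ : iwasawaToPowerSeries 3 Θ =
      ((mazurTateElement f₀ 3 3).map (algebraMap ℚ ℚ_[3]) : PowerSeries ℚ_[3]))
    (hΘ0 : Θ ≠ 0) (hμ : mu Θ = 0) (hlam : lam Θ = (cyclotomicOmegaPlus 3 3).natDegree + 3)
    {Θ' : IwasawaAlgebra 3}
    (hΘ' : iwasawaToPowerSeries 3 Θ' =
      ((mazurTateElement f₀' 3 1).map (algebraMap ℚ ℚ_[3]) : PowerSeries ℚ_[3]))
    (hΘ'0 : Θ' ≠ 0) (hμ' : mu Θ' = 0) (hlam' : lam Θ' = (cyclotomicOmegaPlus 3 1).natDegree + 1) :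
    ∃ ε : ℤˣ, KobayashiLowerDivisibility (⟨1, -1, 1, -34, 25⟩ : WeierstrassCurve ℚ) 3 ε :=
  ⟨(-1), kobayashiLowerDivisibility_of_mainConjecture
    (congl_kobayashiMainConjecture_11858w1_3_odd h12 h41 h5 h3 hL20 hKim hGZK hPollack hf₀ hf₀' hr' hΘ hΘ0 hμ hlam hΘ' hΘ'0 hμ' hlam')⟩

/-- **`congl_11858w1_3`, `BSD(E,3)`** for `11858w1` (X7 ∧ `r_an = 1` ∧ surj, engine-free core) through the MT-road door
`X7.bsdp_of_kobayashiMainConjecture_of_corA5_of_analyticRank_eq_one` from `congl_kobayashiMainConjecture_11858w1_3_odd`: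
+ Burungale–Kobayashi–Ota 2024 Cor. A.5 (`hA5`, its two referee flags displayed there), `hmodr`, `hGZK`, the rank datum
`hr`; class X7 decided in the kernel (good supersingular at `3` with `#Ẽ(𝔽₃) = 4`, additive at `7`). `BSD₃` is ALREADY a
theorem at this pair by other roads (3-descent / Kobayashi 2013 records); this is the Iwasawa-theoretic route. PER PAIR;
nothing booked; BSD is not proved by any of this. [cite: BurungaleKobayashiOta2023, App. A Cor. A.5]
[cite: Kobayashi2003, Thm. 7.4 and Conjecture (p. 2)] [cite: BDKim2009, Cor. 2.13 (p. 187)] [cite: SilvermanAEC2009, VII.5 Prop. 5.1]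
[cite: Miller2011LMS, Def. 1.1] [cite: Cremona2006, Table 1 (Cremona labels 11858w1, 1694c1)] -/
theorem congl_bsdp_11858w1_3
    (hA5 : corA5_pPart_of_signedCharIdeal_eq) (hmodr : hasEntireLFunction_rat)
    (hr : (⟨1, -1, 1, -34, 25⟩ : WeierstrassCurve ℚ).analyticRank = 1)
    (h12 : Kobayashi2003.thm12_signedSelmerDual_finite_torsion)
    (h41 : Kobayashi2003.thm41_signedCharIdeal_divisibility)
    (h5 : realPeriodRat_eq_unit_mul_plusPeriod) (h3 : realPeriodRat_eq_unit_mul_plusPeriod_three)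
    (hL20 : Wuthrich2014.lemma20_surjective_threeAdic_of_semistable)
    (hKim : BDKim2009.cor213_signedLambda_add_sum_delta_eq_of_torsionIso)
    (hGZK : rank_eq_analyticRank_of_analyticRank_le_one)
    [(⟨1, -1, 1, -34, 25⟩ : WeierstrassCurve ℚ).IsElliptic]
    [(⟨1, -1, 1, -34, 25⟩ : WeierstrassCurve ℚ).IsGloballyMinimal]
    [(⟨1, -1, 0, -50, -236⟩ : WeierstrassCurve ℚ).IsElliptic]
    [(⟨1, -1, 0, -50, -236⟩ : WeierstrassCurve ℚ).IsGloballyMinimal]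
    (hPollack : ∀ {N : ℕ} [NeZero N] {f : CuspForm (Gamma0 N) 2},
      pollack_exists_plusMinusPAdicLFunction (W := (⟨1, -1, 0, -50, -236⟩ : WeierstrassCurve ℚ))
        (f := f) (p := 3))
    [NeZero ((⟨1, -1, 1, -34, 25⟩ : WeierstrassCurve ℚ).conductorNorm ℤ)]
    [NeZero ((⟨1, -1, 0, -50, -236⟩ : WeierstrassCurve ℚ).conductorNorm ℤ)]
    {f₀ : CuspForm (Gamma0 ((⟨1, -1, 1, -34, 25⟩ : WeierstrassCurve ℚ).conductorNorm ℤ)) 2}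
    (hf₀ : IsNewformOf (⟨1, -1, 1, -34, 25⟩ : WeierstrassCurve ℚ) f₀)
    {f₀' : CuspForm (Gamma0 ((⟨1, -1, 0, -50, -236⟩ : WeierstrassCurve ℚ).conductorNorm ℤ)) 2}
    (hf₀' : IsNewformOf (⟨1, -1, 0, -50, -236⟩ : WeierstrassCurve ℚ) f₀')
    (hr' : (⟨1, -1, 0, -50, -236⟩ : WeierstrassCurve ℚ).analyticRank = 1)
    {Θ : IwasawaAlgebra 3}
    (hΘ : iwasawaToPowerSeries 3 Θ =
      ((mazurTateElement f₀ 3 3).map (algebraMap ℚ ℚ_[3]) : PowerSeries ℚ_[3]))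
    (hΘ0 : Θ ≠ 0) (hμ : mu Θ = 0) (hlam : lam Θ = (cyclotomicOmegaPlus 3 3).natDegree + 3)
    {Θ' : IwasawaAlgebra 3}
    (hΘ' : iwasawaToPowerSeries 3 Θ' =
      ((mazurTateElement f₀' 3 1).map (algebraMap ℚ ℚ_[3]) : PowerSeries ℚ_[3]))
    (hΘ'0 : Θ' ≠ 0) (hμ' : mu Θ' = 0) (hlam' : lam Θ' = (cyclotomicOmegaPlus 3 1).natDegree + 1) :
    BSDp (⟨1, -1, 1, -34, 25⟩ : WeierstrassCurve ℚ) 3 := by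
  have hI : integralModelInt (⟨1, -1, 1, -34, 25⟩ : WeierstrassCurve ℚ) = ⟨1, -1, 1, -34, 25⟩ :=
    integralModelInt_eq_of_map_eq _ (map_mk_int 1 (-1) 1 (-34) 25)
  have hp2 : (3 : ℕ) ≠ 2 := by decide
  have hn := natCard_point_eq_of_countPoints 1 (-1) 1 (-34) 25 3 hp2 (by decide) countPoints_11858w1_3
  have hX : ClassX7 (⟨1, -1, 1, -34, 25⟩ : WeierstrassCurve ℚ) 3 :=
    classX7_of_intModel 3 hI (by decide) hn (by norm_num) 7 (by norm_num) (by decide) (by decide)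
  have hap : (⟨1, -1, 1, -34, 25⟩ : WeierstrassCurve ℚ).frobeniusTrace 3 = 0 := by
    rw [frobeniusTrace_eq hI hn]; norm_num
  exact X7.bsdp_of_kobayashiMainConjecture_of_corA5_of_analyticRank_eq_one _ 3 hA5 hmodr hGZK hp2 hX hap hr (-1)
    (congl_kobayashiMainConjecture_11858w1_3_odd h12 h41 h5 h3 hL20 hKim hGZK hPollack hf₀ hf₀' hr' hΘ hΘ0 hμ hlam hΘ' hΘ'0 hμ' hlam')

end Summit.BirchSwinnertonDyer.BirchSwinnertonDyer.Theorems.CongruenceRoad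

end
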